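import Summits.AtomisticToContinuum.BoseEinsteinCondensation.Theses.BECStronglyRayleigh
import Summits.AtomisticToContinuum.BoseEinsteinCondensation.Theorems.BECStronglyRayleighInsertionFieldDelocalisationTwoBodyBaseFourier
import Summits.AtomisticToContinuum.BoseEinsteinCondensation.Theorems.BECStronglyRayleighInsertionFieldDelocalisationTorusGreenZeroBounded
import Literature.Probability.LatticeModels.TorusFourierProofs
import Literature.Probability.LatticeModels.LatticeGreenRiemannSum
import HarnessLib

/-!
# Stub `stub_twoBodyL2Flat` (Stub F of line `Sketch`, crux `KineticLatticeBEC`, stmt-AtomisticToContinuum-9671)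

**Two-body `ℓ²`-flatness on the three-torus.** On `(ℤ/Lℤ)³`, `L ≥ 2`, let `g ≥ 0` with `g(0) = 0` solve the
punctured resolvent equation `Σ_{y ∼ v} g(y) + E g(v) = s [v = 0]` (the pair profile of the two-body ground
state of hard-core bosons; `E` the two-particle sector energy), and assume the two-body energy bound
`(deg(0) + E)(L³ − 1) ≤ 6` (landed `cb1tb_energy_bound`). Then `L³ Σ_v g(v)² ≤ (1 + 400/L²) (Σ_v g(v))²`.

Proof. Fourier: `(Λ_k + E) ĝ(k) = s` for every mode (`cb1tb_fourier_eq`), `Λ_k = Σ_{b∼0} χ_k(b)` real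
(`cb1tb_hopSymbol_im`), `Λ_0 = deg(0)`, `ĝ(0) = Σ g =: G`, so `s = η G` with `η := deg(0) + E ≤ 6/(L³−1) ≤ 7/L³`,
and `η ≥ 0` (at `v = 0` the equation reads `s = Σ_{y∼0} g(y) ≥ 0`, and `G ≥ 0`; if `G = 0` then `g ≡ 0`).
For `k ≠ 0` pick a coordinate `i` with `|m_i| = ‖m(k)‖_∞ ≥ 1` (`m_i = valMinAbs (k i)`); dropping all
neighbours of `0` but `e_i` gives `deg(0) − Re Λ_k ≥ 1 − cos p_{k,i} ≥ 8 m_i²/L²` (`g3bd_coord`,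
`g12_torusChar_single_re`, pattern of `cb1tb_hopSymbol_re_le`), hence
`−(Λ_k + E) = (deg(0) − Λ_k) − η ≥ 8‖m‖_∞²/L² − 4/L² ≥ 4‖m‖_∞²/L²` (using `6/(L³−1) ≤ 4/L²` for `L ≥ 2`),
so `|ĝ(k)|² = s²/(Λ_k+E)² ≤ η²G² L⁴/(16 ‖m(k)‖_∞⁴)`. The centred representatives `k ↦ m(k)` inject into the
punctured box `{0 < ‖m‖_∞ ≤ L/2} ⊂ ℤ³` (pattern of `g3bd_sum_inv_dispersion_le`), and the shell count
`|{‖m‖_∞ = r}| ≤ 6(2r+1)²` (`card_sphere_succ_le`) gives `Σ_{m ≠ 0} ‖m‖_∞⁻⁴ ≤ Σ_r 54/r² ≤ 108`.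
Plancherel (`torusFourier_plancherel_holds`): `L³ Σ g² = Σ_k |ĝ(k)|² = G² + Σ_{k≠0}|ĝ(k)|² ≤
G² (1 + (49/L⁶)·(L⁴/16)·108) ≤ (1 + 331/L²) G² ≤ (1 + 400/L²) G²`.
-/

noncomputable section

namespace Summit.AtomisticToContinuum.BoseEinsteinCondensation.Cruxes.KineticLatticeBEC.SectorLadder

open scoped BigOperators ComplexConjugate
open Literature.MathematicalPhysics.QuantumLattice Literature.Probability.LatticeModels Finset
open Summit.AtomisticToContinuum.BoseEinsteinCondensation.Cruxes.InsertionFieldDelocalisation.CoshBudgetPenroseOnsager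
  (cb1tb_fourier_eq cb1tb_hopSymbol_im cb1tb_adj_zero_single)
open Summit.AtomisticToContinuum.BoseEinsteinCondensation.Cruxes.InsertionFieldDelocalisation.LogInsertionInfraredBound
  (g3bd_coord g12_torusChar_single_re)

/-- `η (x³ − 1) ≤ 6` and `x ≥ 2` give `η x² ≤ 4` (as `6/(x³−1) ≤ 4/x²` there). [folklore] -/
theorem tbf_eta_mul_sq_le {η x : ℝ} (hx : 2 ≤ x) (hη : η * (x ^ 3 - 1) ≤ 6) : η * x ^ 2 ≤ 4 := by
  by_contra h
  rw [not_le] at h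
  have hx3 : (2 : ℝ) ^ 3 ≤ x ^ 3 := pow_le_pow_left₀ (by norm_num) hx 3
  have hx1 : 0 < x ^ 3 - 1 := by linarith
  nlinarith [mul_lt_mul_of_pos_right h hx1, mul_le_mul_of_nonneg_right hη (sq_nonneg x),
    mul_le_mul_of_nonneg_right hx (sq_nonneg x)]

/-- `η (x³ − 1) ≤ 6` and `x ≥ 2` give `η x³ ≤ 7` (as `6/(x³−1) ≤ 7/x³` there). [folklore] -/
theorem tbf_eta_mul_cube_le {η x : ℝ} (hx : 2 ≤ x) (hη : η * (x ^ 3 - 1) ≤ 6) : η * x ^ 3 ≤ 7 := by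
  by_contra h
  rw [not_le] at h
  have hx3 : (2 : ℝ) ^ 3 ≤ x ^ 3 := pow_le_pow_left₀ (by norm_num) hx 3
  have hx1 : 0 < x ^ 3 - 1 := by linarith
  have hx0 : (0 : ℝ) ≤ x ^ 3 := by linarith
  nlinarith [mul_lt_mul_of_pos_right h hx1, mul_le_mul_of_nonneg_right hη hx0]

/-- **Jordan bound on the hopping symbol, sup-norm form**: on `(ℤ/Lℤ)³`, `L ≥ 2`,
`Re Λ_k ≤ deg(0) − 8 ‖m(k)‖_∞² / L²` with `m(k)ᵢ = valMinAbs (k i)` (drop all neighbours of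
the origin but `eᵢ` with `|mᵢ| = ‖m(k)‖_∞`, where `1 − cos p_k,i ≥ 8 mᵢ²/L²`). [folklore] -/
theorem tbf_hopSymbol_re_le (L : ℕ) [NeZero L] (hL : 2 ≤ L) (k : TorusSite 3 L) :
    (∑ b, (if (torusGraph 3 L).Adj 0 b then torusChar k b else 0)).re ≤
      (∑ b : TorusSite 3 L, (if (torusGraph 3 L).Adj 0 b then (1 : ℝ) else 0)) -
        8 * ‖(fun i => (k i).valMinAbs : Site 3)‖ ^ 2 / (L : ℝ) ^ 2 := by
  obtain ⟨i, hi⟩ :=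
    Site.exists_natAbs_eq_supNorm Finset.univ_nonempty (fun i => (k i).valMinAbs : Site 3)
  have hnorm : ‖(fun i => (k i).valMinAbs : Site 3)‖ ^ 2 = ((k i).valMinAbs : ℝ) ^ 2 := by
    rw [Site.norm_eq_supNorm, ← hi, Nat.cast_natAbs, Int.cast_abs, sq_abs]
  have hadj : (torusGraph 3 L).Adj 0 (Pi.single i 1) := cb1tb_adj_zero_single hL i
  rw [Complex.re_sum]
  have hre : ∀ b : TorusSite 3 L, (if (torusGraph 3 L).Adj 0 b then torusChar k b else 0).re =
      (if (torusGraph 3 L).Adj 0 b then (1 : ℝ) else 0) -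
        (if (torusGraph 3 L).Adj 0 b then 1 - (torusChar k b).re else 0) := by
    intro b
    split_ifs
    · ring
    · simp
  simp_rw [hre]
  rw [Finset.sum_sub_distrib]
  have hterm : ∀ b ∈ (univ : Finset (TorusSite 3 L)),
      0 ≤ (if (torusGraph 3 L).Adj 0 b then 1 - (torusChar k b).re else 0) := by
    intro b _
    split_ifs
    · have h := Complex.re_le_norm (torusChar k b)
      rw [norm_torusChar] at h
      linarith
    · exact le_rfl
  have hsingle : (if (torusGraph 3 L).Adj 0 (Pi.single i 1) then
      1 - (torusChar k (Pi.single i 1)).re else 0) ≤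
      ∑ b, (if (torusGraph 3 L).Adj 0 b then 1 - (torusChar k b).re else 0) :=
    Finset.single_le_sum hterm (Finset.mem_univ _)
  rw [if_pos hadj, g12_torusChar_single_re] at hsingle
  have hjordan := g3bd_coord L k i
  rw [hnorm]
  linarith

/-- **Nonzero modes of the pair profile are small.** If `Σ_{y ∼ v} g(y) + E g(v) = s [v = 0]`
on `(ℤ/Lℤ)³`, `L ≥ 2`, with `(deg(0) + E) L² ≤ 4`, then for `k ≠ 0`:
`|ĝ(k)|² ≤ s² (L⁴/16) ‖m(k)‖_∞⁻⁴` (`(Λ_k + E) ĝ(k) = s`, `Λ_k + E ≤ −4‖m(k)‖_∞²/L²`). [folklore] -/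
theorem tbf_mode_sq_le (L : ℕ) [NeZero L] (hL : 2 ≤ L) (g : TorusSite 3 L → ℝ) (E s : ℝ)
    (hη : ((∑ b : TorusSite 3 L, (if (torusGraph 3 L).Adj 0 b then (1 : ℝ) else 0)) + E) *
      (L : ℝ) ^ 2 ≤ 4)
    (heq : ∀ v, (∑ y, if (torusGraph 3 L).Adj v y then g y else 0) + E * g v =
      if v = 0 then s else 0)
    {k : TorusSite 3 L} (hk : k ≠ 0) :
    ‖torusFourier (fun x => (g x : ℂ)) k‖ ^ 2 ≤
      s ^ 2 * ((L : ℝ) ^ 4 / 16) * (‖(fun i => (k i).valMinAbs : Site 3)‖ ^ 4)⁻¹ := by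
  have hL0 : (0 : ℝ) < L := by exact_mod_cast Nat.pos_of_ne_zero (NeZero.ne L)
  have hL2 : (0 : ℝ) < (L : ℝ) ^ 2 := by positivity
  set n : Site 3 := fun i => (k i).valMinAbs with hn
  -- `n ≠ 0`, so `‖n‖ ≥ 1`
  have hn0 : n ≠ 0 := by
    intro h
    apply hk
    funext i
    have hi : n i = 0 := by rw [h]; rfl
    exact (ZMod.valMinAbs_eq_zero (k i)).1 hi
  have hn1 : 1 ≤ ‖n‖ := by
    rw [Site.norm_eq_supNorm]
    have h : Site.supNorm n ≠ 0 := fun h => hn0 (Site.supNorm_eq_zero_iff.1 h)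
    exact_mod_cast Nat.one_le_iff_ne_zero.2 h
  have hnpos : 0 < ‖n‖ := by linarith
  set Λ := ∑ b, (if (torusGraph 3 L).Adj 0 b then torusChar k b else 0) with hΛ
  have hΛim : Λ.im = 0 := cb1tb_hopSymbol_im k
  have hΛre := tbf_hopSymbol_re_le L hL k
  rw [← hΛ] at hΛre
  -- `μ := Re Λ + E ≤ -4 ‖n‖² / L²`
  have h4 : 4 / (L : ℝ) ^ 2 ≤ 4 * ‖n‖ ^ 2 / (L : ℝ) ^ 2 := by
    rw [div_le_div_iff_of_pos_right hL2]
    nlinarith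
  have hη' : (∑ b : TorusSite 3 L, (if (torusGraph 3 L).Adj 0 b then (1 : ℝ) else 0)) + E ≤
      4 / (L : ℝ) ^ 2 := by
    rw [le_div_iff₀ hL2]
    exact hη
  have hμ : 4 * ‖n‖ ^ 2 / (L : ℝ) ^ 2 ≤ -(Λ.re + E) := by
    have h8 : 8 * ‖n‖ ^ 2 / (L : ℝ) ^ 2 =
        4 * ‖n‖ ^ 2 / (L : ℝ) ^ 2 + 4 * ‖n‖ ^ 2 / (L : ℝ) ^ 2 := by ring
    linarith
  have hμpos : 0 < 4 * ‖n‖ ^ 2 / (L : ℝ) ^ 2 := by positivity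
  have hμne : Λ.re + E ≠ 0 := by linarith
  -- `(μ : ℂ) · ĝ(k) = s`
  have hprod := cb1tb_fourier_eq g E s heq k
  have hμeq : (Λ + E : ℂ) = ((Λ.re + E : ℝ) : ℂ) := by
    apply Complex.ext
    · simp
    · simp [hΛim]
  rw [← hΛ, hμeq] at hprod
  have hnorm : |Λ.re + E| * ‖torusFourier (fun x => (g x : ℂ)) k‖ = |s| := by
    have h := congrArg (fun z : ℂ => ‖z‖) hprod
    simp only [norm_mul, Complex.norm_real, Real.norm_eq_abs] at h
    exact h
  have hsq : (Λ.re + E) ^ 2 * ‖torusFourier (fun x => (g x : ℂ)) k‖ ^ 2 = s ^ 2 := by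
    have h := congrArg (fun t : ℝ => t ^ 2) hnorm
    simp only [mul_pow, sq_abs] at h
    exact h
  -- `μ² ≥ 16 ‖n‖⁴ / L⁴`
  have hμsq : 16 * ‖n‖ ^ 4 / (L : ℝ) ^ 4 ≤ (Λ.re + E) ^ 2 := by
    have h2 : (4 * ‖n‖ ^ 2 / (L : ℝ) ^ 2) ^ 2 ≤ (-(Λ.re + E)) ^ 2 :=
      pow_le_pow_left₀ hμpos.le hμ 2
    calc 16 * ‖n‖ ^ 4 / (L : ℝ) ^ 4 = (4 * ‖n‖ ^ 2 / (L : ℝ) ^ 2) ^ 2 := by ring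
      _ ≤ (Λ.re + E) ^ 2 := by rw [neg_sq] at h2; exact h2
  have hpos16 : 0 < 16 * ‖n‖ ^ 4 / (L : ℝ) ^ 4 := by positivity
  have hμ2pos : 0 < (Λ.re + E) ^ 2 := by positivity
  calc ‖torusFourier (fun x => (g x : ℂ)) k‖ ^ 2 = s ^ 2 / (Λ.re + E) ^ 2 := by
        rw [eq_div_iff hμ2pos.ne', mul_comm]
        exact hsq
    _ ≤ s ^ 2 / (16 * ‖n‖ ^ 4 / (L : ℝ) ^ 4) :=
        div_le_div_of_nonneg_left (sq_nonneg s) hpos16 hμsq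
    _ = s ^ 2 * ((L : ℝ) ^ 4 / 16) * (‖n‖ ^ 4)⁻¹ := by
        field_simp

/-- **Quartic shell sum on `ℤ³`**: `Σ_{0 < ‖m‖_∞ ≤ R} ‖m‖_∞⁻⁴ ≤ 108 − 108/(R+1)` (shell
decomposition, `|∂Λ_{r}| ≤ 6(2r+1)²`, and `6(2R+3)²/(R+1)⁴ ≤ 108/((R+1)(R+2))`). [folklore] -/
theorem tbf_sum_box_inv_norm_four_le (R : ℕ) :
    ∑ m ∈ (box 3 R).erase 0, (‖m‖ ^ 4)⁻¹ ≤ 108 - 108 / ((R : ℝ) + 1) := by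
  induction R with
  | zero => simp [box_zero_eq]
  | succ R ih =>
    have hsplit : (box 3 (R + 1)).erase 0 = (box 3 R).erase 0 ∪ sphere 3 (R + 1) := by
      rw [sphere_succ_eq_sdiff]
      ext m
      simp only [Finset.mem_erase, Finset.mem_union, Finset.mem_sdiff]
      have h0 : (0 : Site 3) ∈ box 3 R := zero_mem_box _ _
      have hsub : m ∈ box 3 R → m ∈ box 3 (R + 1) := fun h => box_mono _ (Nat.le_succ R) h
      by_cases hm : m ∈ box 3 R
      · simp [hm, hsub hm]
      · simp only [hm, not_false_eq_true, and_true, and_false, false_or]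
        constructor
        · exact fun h => h.2
        · intro h; exact ⟨fun h' => hm (h' ▸ h0), h⟩
    have hdisj : Disjoint ((box 3 R).erase 0) (sphere 3 (R + 1)) := by
      rw [sphere_succ_eq_sdiff, Finset.disjoint_left]
      intro m hm hm'
      exact (Finset.mem_sdiff.1 hm').2 (Finset.mem_of_mem_erase hm)
    rw [hsplit, Finset.sum_union hdisj]
    have hshell : ∑ m ∈ sphere 3 (R + 1), (‖m‖ ^ 4)⁻¹ =
        (#(sphere 3 (R + 1)) : ℝ) * (((R : ℝ) + 1) ^ 4)⁻¹ := by
      rw [Finset.sum_congr rfl fun m hm => by rw [Site.norm_eq_supNorm, mem_sphere.1 hm],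
        sum_const, nsmul_eq_mul]
      push_cast
      ring
    rw [hshell]
    have hcard := card_sphere_succ_le (d := 3) R
    norm_num at hcard
    push_cast
    have hR : (0 : ℝ) ≤ R := Nat.cast_nonneg R
    have hpos1 : (0 : ℝ) < (R : ℝ) + 1 := by positivity
    have hpos2 : (0 : ℝ) < (R : ℝ) + 1 + 1 := by positivity
    have hpos4 : (0 : ℝ) < ((R : ℝ) + 1) ^ 4 := by positivity
    -- the shell contribution is at most `108/(R+1) - 108/(R+2)`
    have hstep : (#(sphere 3 (R + 1)) : ℝ) * (((R : ℝ) + 1) ^ 4)⁻¹ ≤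
        108 / ((R : ℝ) + 1) - 108 / ((R : ℝ) + 1 + 1) := by
      calc (#(sphere 3 (R + 1)) : ℝ) * (((R : ℝ) + 1) ^ 4)⁻¹
          ≤ 6 * (2 * (R : ℝ) + 3) ^ 2 * (((R : ℝ) + 1) ^ 4)⁻¹ := by gcongr
        _ ≤ 108 / ((R : ℝ) + 1) - 108 / ((R : ℝ) + 1 + 1) := by
          rw [div_sub_div _ _ hpos1.ne' hpos2.ne', ← div_eq_mul_inv,
            div_le_div_iff₀ hpos4 (mul_pos hpos1 hpos2)]
          nlinarith [mul_nonneg hR hR, mul_nonneg (mul_nonneg hR hR) hR,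
            mul_nonneg (mul_nonneg (mul_nonneg hR hR) hR) hR]
    linarith

/-- **Sum over the nonzero modes.** Under the hypotheses of `tbf_mode_sq_le`,
`Σ_{k ≠ 0} |ĝ(k)|² ≤ s² (L⁴/16) · 108`: the centred representatives `k ↦ m(k)` inject into the
punctured box `{0 < ‖m‖_∞ ≤ L/2} ⊂ ℤ³`, where `Σ ‖m‖_∞⁻⁴ ≤ 108`
(`tbf_sum_box_inv_norm_four_le`). [folklore] -/
theorem tbf_sum_nonzero_modes_le (L : ℕ) [NeZero L] (hL : 2 ≤ L) (g : TorusSite 3 L → ℝ)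
    (E s : ℝ)
    (hη : ((∑ b : TorusSite 3 L, (if (torusGraph 3 L).Adj 0 b then (1 : ℝ) else 0)) + E) *
      (L : ℝ) ^ 2 ≤ 4)
    (heq : ∀ v, (∑ y, if (torusGraph 3 L).Adj v y then g y else 0) + E * g v =
      if v = 0 then s else 0) :
    ∑ k ∈ (univ : Finset (TorusSite 3 L)).erase 0, ‖torusFourier (fun x => (g x : ℂ)) k‖ ^ 2 ≤
      s ^ 2 * ((L : ℝ) ^ 4 / 16) * 108 := by
  set m : TorusSite 3 L → Site 3 := fun k i => (k i).valMinAbs with hm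
  set S : Finset (TorusSite 3 L) := (univ : Finset (TorusSite 3 L)).erase 0 with hS
  have hinj : Set.InjOn m ↑S := by
    intro k _ k' _ hkk'
    funext i
    have h : m k i = m k' i := by rw [hkk']
    exact ZMod.injective_valMinAbs h
  -- the image lies in the punctured box of radius `L/2`
  have hsub : S.image m ⊆ (box 3 (L / 2)).erase 0 := by
    intro n hn
    rw [Finset.mem_image] at hn
    obtain ⟨k, hk, rfl⟩ := hn
    rw [hS, Finset.mem_erase] at hk
    rw [Finset.mem_erase]
    constructor
    · intro h
      apply hk.1
      funext i
      have hi : m k i = 0 := by rw [h]; rfl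
      exact (ZMod.valMinAbs_eq_zero (k i)).1 hi
    · rw [mem_box]
      intro i
      have h := ZMod.natAbs_valMinAbs_le (k i)
      change -((L / 2 : ℕ) : ℤ) ≤ (k i).valMinAbs ∧ (k i).valMinAbs ≤ ((L / 2 : ℕ) : ℤ)
      omega
  have h1 : ∑ k ∈ S, ‖torusFourier (fun x => (g x : ℂ)) k‖ ^ 2 ≤
      ∑ k ∈ S, s ^ 2 * ((L : ℝ) ^ 4 / 16) * (‖m k‖ ^ 4)⁻¹ := by
    refine Finset.sum_le_sum fun k hk => ?_
    rw [hS, Finset.mem_erase] at hk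
    exact tbf_mode_sq_le L hL g E s hη heq hk.1
  have h2 : ∑ k ∈ S, s ^ 2 * ((L : ℝ) ^ 4 / 16) * (‖m k‖ ^ 4)⁻¹ =
      s ^ 2 * ((L : ℝ) ^ 4 / 16) * ∑ n ∈ S.image m, (‖n‖ ^ 4)⁻¹ := by
    rw [Finset.sum_image hinj, Finset.mul_sum]
  have h3 : ∑ n ∈ S.image m, (‖n‖ ^ 4)⁻¹ ≤ ∑ n ∈ (box 3 (L / 2)).erase 0, (‖n‖ ^ 4)⁻¹ :=
    Finset.sum_le_sum_of_subset_of_nonneg hsub fun n _ _ => by positivity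
  have h4 : ∑ n ∈ (box 3 (L / 2)).erase 0, (‖n‖ ^ 4)⁻¹ ≤ 108 := by
    have h := tbf_sum_box_inv_norm_four_le (L / 2)
    have h' : (0 : ℝ) ≤ 108 / (((L / 2 : ℕ) : ℝ) + 1) := by positivity
    linarith
  calc ∑ k ∈ S, ‖torusFourier (fun x => (g x : ℂ)) k‖ ^ 2
      ≤ ∑ k ∈ S, s ^ 2 * ((L : ℝ) ^ 4 / 16) * (‖m k‖ ^ 4)⁻¹ := h1
    _ = s ^ 2 * ((L : ℝ) ^ 4 / 16) * ∑ n ∈ S.image m, (‖n‖ ^ 4)⁻¹ := h2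
    _ ≤ s ^ 2 * ((L : ℝ) ^ 4 / 16) * 108 := by
        gcongr
        exact h3.trans h4

/-- **Stub F — `TwoBodyL2Flat`.** On `(ℤ/Lℤ)³`, `L ≥ 2`: a nonnegative solution `g` with `g(0) = 0` of
the punctured resolvent equation `Σ_{y ∼ v} g(y) + E g(v) = s [v = 0]` whose parameter satisfies the
two-body energy bound `(deg(0) + E)(L³ − 1) ≤ 6` is `ℓ²`-flat: `L³ Σ_v g(v)² ≤ (1 + 400/L²) (Σ_v g(v))²`.
[folklore] -/
theorem stub_twoBodyL2Flat :
    ∀ (L : ℕ) [NeZero L], 2 ≤ L → ∀ (g : TorusSite 3 L → ℝ) (E s : ℝ),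
      (∀ v, 0 ≤ g v) → g 0 = 0 →
      ((∑ b : TorusSite 3 L, (if (torusGraph 3 L).Adj 0 b then (1 : ℝ) else 0)) + E) *
          ((L : ℝ) ^ 3 - 1) ≤ 6 →
      (∀ v, (∑ y, if (torusGraph 3 L).Adj v y then g y else 0) + E * g v =
        if v = 0 then s else 0) →
      (L : ℝ) ^ 3 * ∑ v, g v ^ 2 ≤ (1 + 400 / (L : ℝ) ^ 2) * (∑ v, g v) ^ 2 := by
  intro L _ hL g E s hg hg0 hE heq
  have hL0 : (0 : ℝ) < L := by exact_mod_cast Nat.pos_of_ne_zero (NeZero.ne L)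
  have hL2 : (2 : ℝ) ≤ L := by exact_mod_cast hL
  set deg0 : ℝ := ∑ b : TorusSite 3 L, (if (torusGraph 3 L).Adj 0 b then (1 : ℝ) else 0)
    with hdeg0
  set G : ℝ := ∑ v, g v with hG
  -- `G ≥ 0`, `s ≥ 0`
  have hG0 : 0 ≤ G := Finset.sum_nonneg fun v _ => hg v
  have hs0 : 0 ≤ s := by
    have h := heq 0
    rw [if_pos rfl, hg0, mul_zero, add_zero] at h
    rw [← h]
    refine Finset.sum_nonneg fun y _ => ?_
    split_ifs
    · exact hg y
    · exact le_rfl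
  -- the zero mode: `η G = s`
  have hηG : (deg0 + E) * G = s := by
    have h := cb1tb_fourier_eq g E s heq 0
    simp only [torusChar_zero_left, torusFourier_apply_zero] at h
    have hdegC : (∑ b, if (torusGraph 3 L).Adj 0 b then (1 : ℂ) else 0) = ((deg0 : ℝ) : ℂ) := by
      rw [hdeg0, Complex.ofReal_sum]
      refine Finset.sum_congr rfl fun b _ => ?_
      split_ifs <;> simp
    have hGC : ∑ x, (g x : ℂ) = ((G : ℝ) : ℂ) := by rw [hG, Complex.ofReal_sum]
    rw [hdegC, hGC] at h
    exact_mod_cast h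
  -- `η L² ≤ 4`, `η L³ ≤ 7`, hence `s L³ ≤ 7 G` and `s² L⁶ ≤ 49 G²`
  have hη4 : (deg0 + E) * (L : ℝ) ^ 2 ≤ 4 := tbf_eta_mul_sq_le hL2 hE
  have hη7 : (deg0 + E) * (L : ℝ) ^ 3 ≤ 7 := tbf_eta_mul_cube_le hL2 hE
  have hsG : s * (L : ℝ) ^ 3 ≤ 7 * G := by
    rw [← hηG]
    nlinarith
  have hs2 : s ^ 2 * (L : ℝ) ^ 6 ≤ 49 * G ^ 2 := by
    have h1 : 0 ≤ s * (L : ℝ) ^ 3 := by positivity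
    nlinarith
  -- Plancherel and the zero mode
  have hP := torusFourier_plancherel_holds (d := 3) (L := L) (fun x => (g x : ℂ))
  simp only [Complex.norm_real, Real.norm_eq_abs, sq_abs] at hP
  rw [← hP]
  have hsplit : ∑ k, ‖torusFourier (fun x => (g x : ℂ)) k‖ ^ 2 =
      ‖torusFourier (fun x => (g x : ℂ)) 0‖ ^ 2 +
        ∑ k ∈ (univ : Finset (TorusSite 3 L)).erase 0, ‖torusFourier (fun x => (g x : ℂ)) k‖ ^ 2 :=
    (Finset.add_sum_erase _ _ (Finset.mem_univ _)).symm
  have h0 : ‖torusFourier (fun x => (g x : ℂ)) 0‖ ^ 2 = G ^ 2 := by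
    rw [torusFourier_apply_zero]
    rw [← Complex.ofReal_sum, Complex.norm_real, Real.norm_eq_abs, sq_abs]
  rw [hsplit, h0]
  have hrest := tbf_sum_nonzero_modes_le L hL g E s hη4 heq
  -- final bookkeeping: `s² (L⁴/16) 108 ≤ (49/L⁶)(27 L⁴/4) G² ≤ (400/L²) G²`
  have hL2pos : (0 : ℝ) < (L : ℝ) ^ 2 := by positivity
  have key : s ^ 2 * ((L : ℝ) ^ 4 / 16) * 108 ≤ 400 / (L : ℝ) ^ 2 * G ^ 2 := by
    rw [div_mul_eq_mul_div, le_div_iff₀ hL2pos]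
    nlinarith [hs2, sq_nonneg G]
  calc G ^ 2 + ∑ k ∈ (univ : Finset (TorusSite 3 L)).erase 0,
        ‖torusFourier (fun x => (g x : ℂ)) k‖ ^ 2 ≤ G ^ 2 + 400 / (L : ℝ) ^ 2 * G ^ 2 := by
        linarith
    _ = (1 + 400 / (L : ℝ) ^ 2) * G ^ 2 := by ring

end Summit.AtomisticToContinuum.BoseEinsteinCondensation.Cruxes.KineticLatticeBEC.SectorLadder

end
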